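import Summits.HodgeConjecture.HodgeConjecture.Theorems.R90S2ArchSmoothTensor          -- ★ p864642 §3′: `archSmooth_archTensor`
import Summits.HodgeConjecture.HodgeConjecture.Theorems.R90S2ArchBlockPairLetterDefs  -- ★ p864785 ℓ1+ℓ6: `IsArchLocSmooth`, `ArchSmoothTensorLetterG`
import HarnessLib

/-!
# R90-TF ∕ S2 «Ch. 12 archimedean block» — CARD 8b `R90S2ArchSmoothTensorLetterOfLocSmooth`: the letter ℓ6′-G IS A THEOREM at the smoothness class of record

Cell `pub/hodgecm-mathlib`, HCML Track R90-TF, section S2 (base `R90-C11`); crux h413 = `stmt-HodgeConjecture-24833`, route of record `HCCMUnconditional`.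
Hand: prover seat hodgecm-mathlib-K2E3-p25 (g5); dealer K2E1b-plan (g8) (DESK WORDS ×6 02:37:24Z (1): «ℓ6′ is now a THEOREM road: `archSmooth_archTensor` + `_update`»;
×7 02:16:24Z (2): «the assembly gets `ArchSmoothTensorLetterG L (fun w => IsArchLocSmooth L (phi3 L) w)` as a one-liner from your head»).  THEOREMS ONLY (proof lane).

## WHAT IS PROVED

`archSmoothTensorLetterG_of_isArchLocSmooth : ArchSmoothTensorLetterG L (fun w φ => IsArchLocSmooth L (phi3 L) w ⇑φ)` — the hypothesis `hℓ6` of the T2 assembly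
★ `archBlockPacketCusp_of_letters` (CARD 8) at the local smoothness currency of record ★ `IsArchLocSmooth` (ambient-restriction form, ★ ℓ1 §0) is DISCHARGED by ★ §3′
`archSmooth_archTensor` (choice over the finite type of complex places); generic twin `archSmooth_archTensor_of_isArchLocSmooth` for any `N`, `H`.  So after the D ED. 3 tie
only ℓ3 and ℓT2-E remain as T2's named letters.

HONEST LABEL: calculus bookkeeping, pays NO printed input; HC_CM is proved only modulo the 7 printed citations (2 remaining named inputs: hLiu418 = `stmt-HodgeConjecture-24832`,
h413 = `stmt-HodgeConjecture-24833`) until rung 0 closes.  Count-neutral helper (`--supports stmt-HodgeConjecture-24833 --as helper`).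

References: [BorelJacquet1979] §4.1; [Rogawski1990] §14.2 p. 233, §13.8 p. 218 L20–28.
-/

set_option autoImplicit false
set_option linter.dupNamespace false

noncomputable section

open NumberField NumberField.InfinitePlace CompactlySupported
open scoped Matrix MatrixGroups Classical ContDiff
open Literature.NumberTheory.Automorphic Literature.NumberTheory.Automorphic.UnitaryGroup Literature.NumberTheory.Rogawski1990
open Summit.HodgeConjecture.HodgeConjecture.R90.S10 (phi3)

namespace Summit.HodgeConjecture.HodgeConjecture.R90.S2

variable (L : Type) [Field L] [NumberField L] [IsCMField L]

/-- **Generic**: a pure tensor of local factors that are ★ `IsArchLocSmooth` (restrictions of ambient `C^∞` functions on `M_N(ℂ)`) is ★ `ArchSmooth L N H` (★ §3′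
`archSmooth_archTensor` after choosing the ambient functions place by place). [cite: BorelJacquet1979, §4.1] [cite: Rogawski1990, §14.2 p. 233] -/
theorem archSmooth_archTensor_of_isArchLocSmooth {N : ℕ} (H : Matrix (Fin N) (Fin N) L)
    (φ : ∀ w : {w : InfinitePlace L // w.IsComplex}, C_c(↥(archLocal L N H w), ℂ)) (hφ : ∀ w, IsArchLocSmooth L H w ⇑(φ w)) :
    ArchSmooth L N H ⇑(archTensor L H φ) := by
  choose fa hfa hφfa using hφ
  exact archSmooth_archTensor L H φ fa hfa hφfa

/-- **CARD 8b — THE LETTER ℓ6′-G IS A THEOREM at the smoothness class of record**: `ArchSmoothTensorLetterG L (fun w φ => IsArchLocSmooth L (phi3 L) w ⇑φ)` — the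
hypothesis `hℓ6` of ★ `archBlockPacketCusp_of_letters` at `S L w := fun φ => IsArchLocSmooth L (phi3 L) w ⇑φ`. [cite: BorelJacquet1979, §4.1] [cite: Rogawski1990, §13.8 p. 218 L20–28] -/
theorem archSmoothTensorLetterG_of_isArchLocSmooth :
    ArchSmoothTensorLetterG L (fun w φ => IsArchLocSmooth L (phi3 L) w ⇑φ) :=
  fun φ hφ => archSmooth_archTensor_of_isArchLocSmooth L (phi3 L) φ hφ

end Summit.HodgeConjecture.HodgeConjecture.R90.S2

end
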